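import Summits.SmoothPoincare4.SmoothPoincare4.Theses.EntropyRung
import Summits.SmoothPoincare4.SmoothPoincare4.Theorems.EntropyRungNoncompactShrinkerGapCarrilloNiClauses
import Summits.SmoothPoincare4.SmoothPoincare4.Theorems.EntropyRungConicalGapStubWeightedIdentity
import Summits.SmoothPoincare4.SmoothPoincare4.Theorems.EntropyRungConicalGapStubWeightedIntegrability
import Summits.SmoothPoincare4.SmoothPoincare4.Theorems.EntropyRungConicalGapStubTransformFinite
import Summits.SmoothPoincare4.SmoothPoincare4.Theorems.EntropyRungConicalGapStubTransformLimit
import Literature.Geometry.Lorentzian.CurvatureRegularity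
import Literature.Geometry.Riemannian.PerelmanEntropyCutoff

/-!
# Crux `EntropyRung.ConicalGap` (stmt-SmoothPoincare4-16589) — line `Sketch` (card `avr-window`), skeleton v1

Lead `prover-line-stmt-SmoothPoincare4-16589-0` (gen 1, 2026-08-16), continued by lead seats c1, c2, c3;
`prover-line-stmt-SmoothPoincare4-16589-c1-0` (same registered stubs; LANDED stubs are discharged in place by the
tree theorem — `stub_weightedIdentity` ✔ p127048, `stub_weightedIntegrability` ✔ p127392, `stub_transformFinite`
✔ p127494, `stub_transformLimit` ✔ p127115, all in `Theorems.ConicalGapSketch`; OPEN: the apex `stub_coreBudget`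
only). The attached `Sketch.lean` proved a
consequence of the crux (`ConicalGap → ThinCone`); this skeleton is the card's TRANSFER, which concludes the
crux BY NAME: the Gaussian-density transform of Wang–Wang 2023 (arXiv:2308.06560, Prop. 2.6, (2.7)–(2.10)),
`h(τ) = (4πτ)⁻² ∫ e^{-f/τ} dV`, `h′(τ) = (4π)⁻² τ⁻⁴ (1 − τ) ∫ R e^{-f/τ} dV`, integrated over `τ ∈ [1, ∞)`:
on every complete connected normalised 4-d gradient shrinker

  `∫ e^{-f} dV = 16π² · a + ∫ R(x) k(f(x)) dV(x)`,  `a = lim_{T→∞} (16π²T²)⁻¹ ∫ e^{-f/T} dV ≥ 0`,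
  `k(t) = ∫₁^∞ (τ − 1) τ⁻⁴ e^{-t/τ} dτ = ∫₀¹ σ(1 − σ) e^{-σt} dσ ∈ (0, 1/6]`

(`a` = AVR on the asymptotically conical class, W–W (2.6); the regularised limit exists on every shrinker by
monotonicity, so no co-area formula is needed). Stubs:

* `stub_weightedIntegrability` — `e^{-f/τ}, f e^{-f/τ}, R e^{-f/τ} ∈ L¹(dV)` for every `τ > 0` (cut-off
  weighted-volume inequality + Fatou, the technique of `integrable_exp_neg_of_proper`; `R ≥ 0` and properness of
  `f` are theorems of the tree);
* `stub_weightedIdentity` — W–W (2.9)–(2.10): `∫ (f − 2τ) e^{-f/τ} dV = (1 − τ) ∫ R e^{-f/τ} dV`, i.e.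
  `∫ Δ(e^{-f/τ}) dV = 0` (`integral_dalembertian_eq_zero_of_proper`, `DalembertianCompose`);
* `stub_transformFinite` — pure measure theory: Fubini on `X × [1, T]` and the pointwise primitive
  `∂_τ (τ⁻² e^{-t/τ}) = τ⁻⁴ (t − 2τ) e^{-t/τ}` give `∫ e^{-f} = T⁻² ∫ e^{-f/T} + ∫ R k_T(f)`;
* `stub_transformLimit` — pure measure theory: monotone limit `T → ∞`;
* `stub_coreBudget` — THE APEX (open core in transformed coordinates): on the crux class,
  `16π² a + ∫ R k(f) dV ≤ 32π²√π e^{-3/2}`. Equivalent to the crux given the four stubs above; implies the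
  card's ThinCone `a ≤ Θ(S³×ℝ) = 2√π e^{-3/2}`.

`sorry` lives ONLY in the open `stub_*` theorems (landed ones are one-line references to the tree);
`ConicalGap_of` concludes the crux BY NAME.

Cycle 3 (lead seat c3, 2026-08-16/17) — the ENTROPY SIDE of the apex, UNCONDITIONAL (all in
`Theorems.ConicalGapSketch`, `--supports` this crux; no named fact used anywhere): exact log-transform
`log ∫e^{-f} = log(T⁻²∫e^{-f/T}) + ∫₁ᵀ (τ−1)τ⁻²⟨R⟩_τ dτ` (`helper_logDensity_eq_transform`, p131843, from
`helper_transformFinite_iterated` p131422, `helper_weightedMass_continuousOn` p131443, `helper_logTransform(_le)`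
p131608); HALF-SUP FENCE `∫e^{-f} ≤ 16π²·a·exp(½ sup_{τ≥1} τ⟨R⟩_τ)` and the crux on that sub-class
(`helper_density_le_avr_mul_exp_halfSup`, `helper_conicalGap_of_halfSupFence`, p131843); second weighted identity
and `Var_τ f = 2τ² − τ²⟨R⟩_τ + (1−τ)Cov_τ(f,R)` (p131614); scale derivatives and `m′ = ⟨R⟩_τ + Cov_τ(f,R)/τ`
for the cone-excess profile `m = τ⟨R⟩_τ` (p132110); Ricci moment identity `2∫|Ric|²e^{-f/τ} = …` modulo
integrability (p132292); `P: ∀τ≥1, ∫(f−τ)Re^{-f/τ} ≥ 0 ⇒ m ↑` (p132548) `⇒ Θ ≤ a e^{ρ/2}` and the crux on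
`{P, 16π² a e^{ρ/2} ≤ 32π²√πe^{-3/2}}` (`helper_conicalGap_of_curvatureLevel`); Wang–Wang Prop 2.6 monotonicity
of `τ⁻²∫e^{-f/τ}` on both sides of `τ = 1` (p132556). The apex itself is unchanged (= the open problem).

Cycle 4 (lead seat c4, 2026-08-17) — the RICCI SIDE of the apex, UNCONDITIONAL (all in
`Theorems.ConicalGapSketch`, `--supports` this crux; no named fact used anywhere): the Munteanu–Sesum
weighted `L²` bound `∫|Ric|²e^{-f/τ} < ∞`, `g⁻¹(dR,df)e^{-f/τ} ∈ L¹` for EVERY `τ > 0`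
(`helper_ricciNormSq_cutoff_integral_le` p134049, `helper_ricciNormSq_integrable` p134963: cut-off
Green identity + Hamilton `Δ_f R = R − 2|Ric|²` + Cauchy–Schwarz absorption, any dimension); pointwise
`|∇R|² ≤ 4|Ric|²|∇f|²` (p133539); all polynomial moments (p133563); hence UNCONDITIONALLY the Ricci
moment identity at every scale, the classical `2∫|Ric|²e^{-f} = ∫Re^{-f}`, `∫R²e^{-f} ≤ 2∫Re^{-f}`,
`∫g⁻¹(dR,df)e^{-f/τ}` in closed form and the CONE-EXCESS DERIVATIVE IN RICCI FORM
`τ(τ−1)m′ = 2τ²⟨|Ric|²⟩_τ − (τ−1)²Var_τ(R) − τ⟨R⟩_τ` (p135236); the Ricci-level fence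
`∀τ>1, (τ−1)²∫R²v + τ∫Rv ≤ 2τ²∫|Ric|²v ⇒ Θ ≤ a e^{ρ/2}` and the crux on that sub-class (p133516,
unconditional in p135236); the weighted Bochner identity `∫|∇R|²v = 2∫R|Ric|²v − ∫R²v − (1−τ⁻¹)∫R g⁻¹(dR,df)v`
(p134908, unconditional in p135237); the traceless split `|Ric|² = |E|² + R²/4` and the traceless
Ricci moment identity `2∫|E|²e^{-f} = ∫Re^{-f} − ½∫R²e^{-f}` (p134836, p135237); and the Ricci
pinching gap `sup 2|Ric|²/R ≥ 1` on non-flat complete shrinkers (p135313). The apex itself is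
unchanged (= the open problem).

Cycle 5 (lead seat c5, 2026-08-17) — LOCALISATION of the line to the sublevel sets of `f`, UNCONDITIONAL
(all in `Theorems.ConicalGapSketch`, `--supports` this crux; no named fact used anywhere): the test-function
forms of the Wang–Wang and Ricci identities for every bounded `C¹` weight `η(f)`
(`∫e^{-f/τ}η(f)(f − 2τ + (τ−1)R) = τ∫e^{-f/τ}η′(f)|∇f|²`, p136696; Ricci twin p136802; compactly
supported forms p136763, p136688; signed core/end split p137626); the ramp/step limit lemma (p137109)
and hence the exact SUBLEVEL IDENTITIES `∫_{f<t}(2t − 3f + (1+f−t)R) dV = 0`, `∫_{f<t}R ≤ 2Vol{f<t}`,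
`∫_{f<t}[(t−f−1)g⁻¹(dR,df) + (t−f)(R−2|Ric|²)] dV = 0` (p137626); the layer cake (p137442) and the
exact ODE of the volume profile `t·Vol{f<t} − 3∫₀ᵗVol{f<s}ds = ∫_{f<t}(1+f−t)R`, the integral
inequality `(t−2)Vol{f<t} ≤ 3∫₀ᵗVol{f<s}ds`, monotonicity of `(∫₀ᵗVol{f<s}ds)/(t−2)³` (p137422), an
EXPLICIT Cao–Zhou volume growth `Vol{f<t} ≤ 9·Vol{f<3}·(t−2)²` (t ≥ 3), and — via the monotone
Tauberian step (p137485) — the EXISTENCE of the asymptotic volume ratio `lim Vol{f<t}/(8π²t²)` on every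
complete connected normalised 4-d shrinker, equal to the line's regularised `a` and fenced at every
finite level by the core profile, `8π²a(t−2)³ ≤ 3∫₀ᵗVol{f<s}ds` (EntropyRungConicalGapSublevelAvr). The
apex itself is unchanged (= the open problem); the lead's cycle-5 report (`Lines/Sketch.md`) quantifies
the reach of the transform line (M-fence certifies round-link cones only for λ ∈ [.621, .815] while the
crux needs all λ < .925) and declares the line dead as a route to the crux (`Lines/Sketch.dead.md`).
-/

noncomputable section

set_option linter.dupNamespace false

open scoped Manifold ContDiff ENNReal NNReal Topology
open MeasureTheory Set Filter
open Literature.Geometry.Lorentzian Literature.Geometry.Riemannian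

namespace Summit.SmoothPoincare4.SmoothPoincare4.Cruxes.ConicalGap.AvrWindow

open Summit.SmoothPoincare4.SmoothPoincare4.Theorems

/-! ## Registered stubs (v1) -/

/-- Stub 1 — LANDED p127392 (Wang–Wang 2023, proof of Prop. 2.6, "the validity of `h(τ)` is ensured by the quadratic growth of
`f`"; Carrillo–Ni 2009 Cor. 2.1 technique): on a complete connected normalised 4-d gradient shrinker the weights
`e^{-f/τ}`, `f e^{-f/τ}`, `R e^{-f/τ}` are integrable for EVERY `τ > 0`. -/
theorem stub_weightedIntegrability : ∀ (M : Type) [TopologicalSpace M] [T2Space M] [SecondCountableTopology M] [ChartedSpace (EuclideanSpace ℝ (Fin 4)) M] [IsManifold (𝓡 4) ∞ M] [ConnectedSpace M] [T3Space M] [MeasurableSpace M] [BorelSpace M] (g : Literature.Geometry.Lorentzian.PseudoRiemannianMetric (𝓡 4) ∞ (EuclideanSpace ℝ (Fin 4)) (TangentSpace (𝓡 4) : M → Type _)) [g.HasLeviCivita] (f : M → ℝ) (hg : g.IsRiemannian), (∀ (x : M) (r : NNReal), IsCompact {y : M | g.edist hg x y ≤ r}) → ContMDiff (𝓡 4) 𝓘(ℝ,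 ℝ) ∞ f → (∀ (x : M) (X Y : TangentSpace (𝓡 4) x), g.ricci x X Y + g.hessian f x X Y = (1 / 2 : ℝ) * g.val x X Y) → (∀ x : M, g.scalarCurvature x + g.gradSq f x = f x) → ∀ τ : ℝ, 0 < τ → MeasureTheory.Integrable (fun x ↦ Real.exp (-f x / τ)) (Literature.Geometry.Lorentzian.riemannianMeasure (g.toContMDiffRiemannianMetric hg)) ∧ MeasureTheory.Integrable (fun x ↦ f x * Real.exp (-f x / τ)) (Literature.Geometry.Lorentzian.riemannianMeasure (g.toContMDiffRiemannianMetric hg)) ∧ MeasureTheory.Integrable (fun x ↦ g.scalarCurvature x * Real.exp (-f x / τ)) (Literature.Geometry.Lorentzian.riemannianMeasure (g.toContMDiffRiemannianMetric hg)) :=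
  -- LANDED (p127392): Theorems/EntropyRungConicalGapStubWeightedIntegrability.lean
  ConicalGapSketch.stub_weightedIntegrability

/-- Stub 2 — LANDED p127048 (Wang–Wang 2023, (2.9)–(2.10), `n = 4`): on a complete connected normalised 4-d gradient shrinker,
for every `τ > 0`, `∫ (f − 2τ) e^{-f/τ} dV = (1 − τ) ∫ R e^{-f/τ} dV` — the vanishing of `∫ Δ_g(e^{-f/τ}) dV`
(`Δ(e^{-f/τ}) = τ⁻² e^{-f/τ} (f − 2τ + (τ − 1) R)` by `Δf = 2 − R`, `|∇f|² = f − R`), given the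
integrability of the three weights. -/
theorem stub_weightedIdentity : ∀ (M : Type) [TopologicalSpace M] [T2Space M] [SecondCountableTopology M] [ChartedSpace (EuclideanSpace ℝ (Fin 4)) M] [IsManifold (𝓡 4) ∞ M] [ConnectedSpace M] [T3Space M] [MeasurableSpace M] [BorelSpace M] (g : Literature.Geometry.Lorentzian.PseudoRiemannianMetric (𝓡 4) ∞ (EuclideanSpace ℝ (Fin 4)) (TangentSpace (𝓡 4) : M → Type _)) [g.HasLeviCivita] (f : M → ℝ) (hg : g.IsRiemannian), (∀ (x : M) (r : NNReal), IsCompact {y : M | g.edist hg x y ≤ r}) → ContMDiff (𝓡 4) 𝓘(ℝ, ℝ) ∞ f → (∀ (x : M) (X Y : TangentSpace (𝓡 4) x), g.ricci x X Y + g.hessian f x X Y = (1 / 2 : ℝ) * g.val x X Y) → (∀ x : M, g.scalarCurvature x + g.gradSq f x = f x) → (∀ τ : ℝ, 0 < τ → MeasureTheory.Integrable (fun x ↦ Real.exp (-f x / τ)) (Literature.Geometry.Lorentzian.riemannianMeasure (g.toContMDiffRiemannianMetric hg)) ∧ MeasureTheory.Integrable (fun x ↦ f x * Real.exp (-f x /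 τ)) (Literature.Geometry.Lorentzian.riemannianMeasure (g.toContMDiffRiemannianMetric hg)) ∧ MeasureTheory.Integrable (fun x ↦ g.scalarCurvature x * Real.exp (-f x / τ)) (Literature.Geometry.Lorentzian.riemannianMeasure (g.toContMDiffRiemannianMetric hg))) → ∀ τ : ℝ, 0 < τ → ∫ x, (f x - 2 * τ) * Real.exp (-f x / τ) ∂(Literature.Geometry.Lorentzian.riemannianMeasure (g.toContMDiffRiemannianMetric hg)) = (1 - τ) * ∫ x, g.scalarCurvature x * Real.exp (-f x / τ) ∂(Literature.Geometry.Lorentzian.riemannianMeasure (g.toContMDiffRiemannianMetric hg)) :=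
  -- LANDED (p127048): Theorems/EntropyRungConicalGapStubWeightedIdentity.lean
  ConicalGapSketch.stub_weightedIdentity

/-- Stub 3 — LANDED p127494 (the finite transform, pure measure theory): for a σ-finite measure `μ`, continuous `f, R ≥ 0` with
the three weights integrable for every `τ > 0` and the weighted identity for every `τ > 0`, one has for every
`T ≥ 1`: `∫ e^{-f} dμ = T⁻² ∫ e^{-f/T} dμ + ∫ R(x) k_T(f(x)) dμ`, `k_T(t) = ∫₁^T (τ − 1) τ⁻⁴ e^{-t/τ} dτ`
(Fubini on `X × [1, T]`; `∂_τ (τ⁻² e^{-t/τ}) = τ⁻⁴ (t − 2τ) e^{-t/τ}`). -/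
theorem stub_transformFinite : ∀ (X : Type) [TopologicalSpace X] [SecondCountableTopology X] [MeasurableSpace X] [BorelSpace X] (μ : MeasureTheory.Measure X) [MeasureTheory.SigmaFinite μ] (f R : X → ℝ), Continuous f → Continuous R → (∀ x, 0 ≤ f x) → (∀ x, 0 ≤ R x) → (∀ τ : ℝ, 0 < τ → MeasureTheory.Integrable (fun x ↦ Real.exp (-f x / τ)) μ ∧ MeasureTheory.Integrable (fun x ↦ f x * Real.exp (-f x / τ)) μ ∧ MeasureTheory.Integrable (fun x ↦ R x * Real.exp (-f x / τ)) μ) → (∀ τ : ℝ, 0 < τ → ∫ x, (f x - 2 * τ) * Real.exp (-f x / τ) ∂μ = (1 - τ) * ∫ x, R x * Real.exp (-f x / τ) ∂μ) → ∀ T : ℝ, 1 ≤ T → MeasureTheory.Integrable (fun x ↦ R x * ∫ τ in (1 : ℝ)..T, (τ - 1) / τ ^ 4 * Real.exp (-f x / τ)) μ ∧ ∫ x, Real.exp (-f x) ∂μ = (T ^ 2)⁻¹ * (∫ x, Real.exp (-f x / T) ∂μ) + ∫ x, R x * (∫ τ in (1 : ℝ)..T, (τ - 1) / τ ^ 4 *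 Real.exp (-f x / τ)) ∂μ :=
  -- LANDED (p127494): Theorems/EntropyRungConicalGapStubTransformFinite.lean
  ConicalGapSketch.stub_transformFinite

/-- Stub 4 — LANDED p127115 (the monotone limit, pure measure theory): under the hypotheses of Stub 3 and its conclusion for every
`T ≥ 1`, the regularised asymptotic volume ratio `a = lim_{T→∞} (16π²T²)⁻¹ ∫ e^{-f/T} dμ ≥ 0` exists, `R·k(f)` is
integrable for `k(t) = ∫₁^∞ (τ − 1) τ⁻⁴ e^{-t/τ} dτ`, and `∫ e^{-f} dμ = 16π² a + ∫ R k(f) dμ`. -/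
theorem stub_transformLimit : ∀ (X : Type) [TopologicalSpace X] [SecondCountableTopology X] [MeasurableSpace X] [BorelSpace X] (μ : MeasureTheory.Measure X) [MeasureTheory.SigmaFinite μ] (f R : X → ℝ), Continuous f → Continuous R → (∀ x, 0 ≤ f x) → (∀ x, 0 ≤ R x) → (∀ τ : ℝ, 0 < τ → MeasureTheory.Integrable (fun x ↦ Real.exp (-f x / τ)) μ ∧ MeasureTheory.Integrable (fun x ↦ f x * Real.exp (-f x / τ)) μ ∧ MeasureTheory.Integrable (fun x ↦ R x * Real.exp (-f x / τ)) μ) → (∀ T : ℝ, 1 ≤ T → MeasureTheory.Integrable (fun x ↦ R x * ∫ τ in (1 : ℝ)..T, (τ - 1) / τ ^ 4 * Real.exp (-f x / τ)) μ ∧ ∫ x, Real.exp (-f x) ∂μ = (T ^ 2)⁻¹ * (∫ x, Real.exp (-f x / T) ∂μ) + ∫ x, R x * (∫ τ in (1 : ℝ)..T, (τ - 1) / τ ^ 4 * Real.exp (-f x / τ)) ∂μ) → ∃ a : ℝ, 0 ≤ a ∧ Filter.Tendsto (fun T : ℝ ↦ (16 * Real.pi ^ 2 * T ^ 2)⁻¹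 * ∫ x, Real.exp (-f x / T) ∂μ) Filter.atTop (nhds a) ∧ MeasureTheory.Integrable (fun x ↦ R x * ∫ τ in Set.Ioi (1 : ℝ), (τ - 1) / τ ^ 4 * Real.exp (-f x / τ)) μ ∧ ∫ x, Real.exp (-f x) ∂μ = 16 * Real.pi ^ 2 * a + ∫ x, R x * (∫ τ in Set.Ioi (1 : ℝ), (τ - 1) / τ ^ 4 * Real.exp (-f x / τ)) ∂μ :=
  -- LANDED (p127115): Theorems/EntropyRungConicalGapStubTransformLimit.lean
  ConicalGapSketch.stub_transformLimit

/-- Stub 5 — THE APEX (open core of the crux in transformed coordinates; card `avr-window`, Transfer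
`C⁺ = ThinCone ∧ CoreBudget`): on the crux class (complete connected non-compact non-flat normalised 4-d gradient
shrinker with `R → 0` at infinity), for the regularised asymptotic volume ratio `a`,
`16π² a + ∫ R k(f) dV ≤ 32π²√π e^{-3/2}` (`k(t) = ∫₁^∞ (τ − 1) τ⁻⁴ e^{-t/τ} dτ`). Junk-free in `ℝ≥0∞`.
No theorem in print; equivalent to the crux given Stubs 1–4. -/
theorem stub_coreBudget : ∀ (M : Type) [TopologicalSpace M] [T2Space M] [SecondCountableTopology M] [ChartedSpace (EuclideanSpace ℝ (Fin 4)) M] [IsManifold (𝓡 4) ∞ M] [ConnectedSpace M] [NoncompactSpace M] [T3Space M] [MeasurableSpace M] [BorelSpace M] (g : Literature.Geometry.Lorentzian.PseudoRiemannianMetric (𝓡 4) ∞ (EuclideanSpace ℝ (Fin 4)) (TangentSpace (𝓡 4) : M → Type _)) [g.HasLeviCivita] (f : M → ℝ) (hg : g.IsRiemannian), (∀ (x : M) (r : NNReal), IsCompact {y : M | g.edist hg x y ≤ r}) → ContMDiff (𝓡 4) 𝓘(ℝ, ℝ) ∞ f → (∀ (x : M) (X Y : TangentSpace (𝓡 4)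 x), g.ricci x X Y + g.hessian f x X Y = (1 / 2 : ℝ) * g.val x X Y) → (∀ x : M, g.scalarCurvature x + g.gradSq f x = f x) → (∃ x : M, g.scalarCurvature x ≠ 0) → (∀ ε : ℝ, 0 < ε → ∃ K : Set M, IsCompact K ∧ ∀ x, x ∉ K → g.scalarCurvature x < ε) → ∀ a : ℝ, Filter.Tendsto (fun T : ℝ ↦ (16 * Real.pi ^ 2 * T ^ 2)⁻¹ * ∫ x, Real.exp (-f x / T) ∂(Literature.Geometry.Lorentzian.riemannianMeasure (g.toContMDiffRiemannianMetric hg))) Filter.atTop (nhds a) → ENNReal.ofReal (16 * Real.pi ^ 2 * a) + ∫⁻ x, ENNReal.ofReal (g.scalarCurvature x * ∫ τ in Set.Ioi (1 : ℝ), (τ - 1) / τ ^ 4 * Real.exp (-f x / τ)) ∂(Literature.Geometry.Lorentzian.riemannianMeasure (g.toContMDiffRiemannianMetric hg)) ≤ ENNReal.ofReal (32 * Real.pi ^ 2 * Real.sqrt Real.pi * Real.exp (-(3 : ℝ) / 2)) := by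
  sorry

/-! ## The composition (sorry-free; concludes the crux BY NAME) -/

/-- The kernel `k(t) = ∫₁^∞ (τ − 1) τ⁻⁴ e^{-t/τ} dτ` is non-negative. -/
theorem kernel_nonneg (t : ℝ) : 0 ≤ ∫ τ in Set.Ioi (1 : ℝ), (τ - 1) / τ ^ 4 * Real.exp (-t / τ) :=
  setIntegral_nonneg measurableSet_Ioi fun τ hτ ↦
    mul_nonneg (div_nonneg (by linarith [show (1 : ℝ) < τ from hτ]) (by positivity)) (Real.exp_pos _).le

/-- **`ConicalGap_of`** (v1): the crux BY NAME from the five registered stubs — `R ≥ 0`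
(`shrinkerScalarCurvature_nonneg_holds`), `f ≥ 0`, properness (`scalarCurvature_nonneg_and_isCompact_sublevel`) and
σ-finiteness of `dV` from the tree; then Stubs 1 → 2 → 3 → 4 give `∫ e^{-f} = 16π² a + ∫ R k(f)` with integrable
`R k(f)`, Stub 5 bounds the right side in `ℝ≥0∞`, and `∫⁻ ofReal = ofReal ∫` closes. -/
theorem ConicalGap_of : Summit.SmoothPoincare4.SmoothPoincare4.Theses.EntropyRung.ConicalGap := by
  intro M _ _ _ _ _ _ _ _ _ _ g _ f hg hc hf hsol hnorm hnf hdec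
  -- `R ≥ 0`, `f ≥ 0`, continuity of `R`, properness of `f`
  have hR0 : ∀ x, 0 ≤ g.scalarCurvature x :=
    shrinkerScalarCurvature_nonneg_holds 4 M g f hg hc hf hsol hnorm
  have hf0 : ∀ x, 0 ≤ f x := fun x ↦ by
    have h1 := hnorm x
    have h2 := g.gradSq_nonneg hg f x
    linarith [hR0 x]
  have hRc : Continuous fun x ↦ g.scalarCurvature x :=
    (PseudoRiemannianMetric.contMDiff_scalarCurvature g).continuous
  -- measure-theoretic instances for `dV`
  haveI : LocallyCompactSpace M := Manifold.locallyCompact_of_finiteDimensional (M := M) (𝓡 4)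
  haveI : IsFiniteMeasureOnCompacts (riemannianMeasure (g.toContMDiffRiemannianMetric hg)) := by
    have h := CarrilloNi2009_shrinkerLSI.isFiniteMeasureOnCompacts_riemVolume hg
    rwa [PseudoRiemannianMetric.riemVolume_eq hg] at h
  haveI : IsLocallyFiniteMeasure (riemannianMeasure (g.toContMDiffRiemannianMetric hg)) :=
    isLocallyFiniteMeasure_of_isFiniteMeasureOnCompacts
  haveI : SigmaFinite (riemannianMeasure (g.toContMDiffRiemannianMetric hg)) := by infer_instance
  -- the chain of stubs
  have hA := stub_weightedIntegrability M g f hg hc hf hsol hnorm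
  have hB := stub_weightedIdentity M g f hg hc hf hsol hnorm hA
  have hC := stub_transformFinite M (riemannianMeasure (g.toContMDiffRiemannianMetric hg)) f
    (fun x ↦ g.scalarCurvature x) hf.continuous hRc hf0 hR0 hA hB
  obtain ⟨a, ha0, hlim, hint, hZ⟩ := stub_transformLimit M (riemannianMeasure (g.toContMDiffRiemannianMetric hg))
    f (fun x ↦ g.scalarCurvature x) hf.continuous hRc hf0 hR0 hA hC
  have hbudget := stub_coreBudget M g f hg hc hf hsol hnorm hnf hdec a hlim
  -- glue: `∫⁻ ofReal (e^{-f}) = ofReal (∫ e^{-f}) = ofReal (16π² a) + ∫⁻ ofReal (R k(f))`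
  obtain ⟨hI1, -, -⟩ := hA 1 one_pos
  have hI1' : Integrable (fun x ↦ Real.exp (-f x))
      (riemannianMeasure (g.toContMDiffRiemannianMetric hg)) := by
    simpa only [div_one] using hI1
  have hker : ∀ x, 0 ≤ g.scalarCurvature x *
      ∫ τ in Set.Ioi (1 : ℝ), (τ - 1) / τ ^ 4 * Real.exp (-f x / τ) :=
    fun x ↦ mul_nonneg (hR0 x) (kernel_nonneg (f x))
  calc ∫⁻ x, ENNReal.ofReal (Real.exp (-f x)) ∂(riemannianMeasure (g.toContMDiffRiemannianMetric hg))
      = ENNReal.ofReal (∫ x, Real.exp (-f x) ∂(riemannianMeasure (g.toContMDiffRiemannianMetric hg))) :=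
        (ofReal_integral_eq_lintegral_ofReal hI1' (ae_of_all _ fun x ↦ (Real.exp_pos _).le)).symm
    _ = ENNReal.ofReal (16 * Real.pi ^ 2 * a) +
          ∫⁻ x, ENNReal.ofReal (g.scalarCurvature x *
            ∫ τ in Set.Ioi (1 : ℝ), (τ - 1) / τ ^ 4 * Real.exp (-f x / τ))
            ∂(riemannianMeasure (g.toContMDiffRiemannianMetric hg)) := by
        rw [hZ, ENNReal.ofReal_add (by positivity) (integral_nonneg hker),
          ofReal_integral_eq_lintegral_ofReal hint (ae_of_all _ hker)]
    _ ≤ ENNReal.ofReal (32 * Real.pi ^ 2 * Real.sqrt Real.pi * Real.exp (-(3 : ℝ) / 2)) := hbudget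

end Summit.SmoothPoincare4.SmoothPoincare4.Cruxes.ConicalGap.AvrWindow

end
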